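import Summits.AtomisticToContinuum.Crystallization.Theorems.HullExactificationCascadeHullGoodEverywhereGoodAPI
import Summits.AtomisticToContinuum.Crystallization.Theorems.HullExactificationCascadeHullGoodEverywhereSnap

/-!
# `HullGoodEverywhere` (route `HullExactificationCascade`, item D): goodness passes to local limits

The core of EXACTIFICATION no. 1: if `δ`-separated point sets `Y k ⊆ ℝ³` converge locally to a
`δ`-separated `S`, `p k ∈ Y k` converge to `y ∈ S`, and every `p k` is `PatternGood P R₀` in `Y k`
(pattern `P` of unit vectors, scale `≤ R₀`), then `y` is `PatternGood P R₀` in `S`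
(`hge_patternGood_of_limit`).  Proof: unbundle the data `(d_k, A_k, q_k)` at `p k`
(`PatternGood.exists_data`), extract a subsequence along which the isometries `A_k`, the scales
`d_k ∈ [δ, R₀]` and the twelve offsets `q_k v - p k` converge (`hge_extract_isometry`,
`hge_extract_bounded`), and check that the limits are data for `y` in `S`
(`patternGood_of_data`): limits of members lie in `S`, separation persists, the closed matching
condition `≤ 1/20` persists, every point of `S ∖ {y}` is followed back along approximants
(`hge_exists_approx`) and is either a labelled neighbour (pigeonhole over the finite pattern) or at
distance `≥ 13 d/10`, and the minimal distance is attained at a fixed label frequently.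
-/

noncomputable section

namespace Summit.AtomisticToContinuum.Crystallization.Theorems

open Literature.MathematicalPhysics.StatisticalMechanics Literature.Geometry.DiscreteGeometry
open Filter Topology Metric

/-- Evaluation along a sequence of isometries converging in operator norm: if
`‖B k v - A v‖ ≤ ε ‖v‖` for all `v` eventually (every `ε > 0`), each `B k` is an isometry and
`u k → u₀`, then `B k (u k) → A u₀`. [folklore] -/
theorem hge_tendsto_isometry_apply {B : ℕ → ((EuclideanSpace ℝ (Fin 3)) →ₗᵢ[ℝ] (EuclideanSpace ℝ (Fin 3)))} {A : (EuclideanSpace ℝ (Fin 3)) →ₗᵢ[ℝ] (EuclideanSpace ℝ (Fin 3))}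
    (hB : ∀ ε : ℝ, 0 < ε → ∀ᶠ k in atTop, ∀ v : (EuclideanSpace ℝ (Fin 3)), ‖B k v - A v‖ ≤ ε * ‖v‖)
    {u : ℕ → (EuclideanSpace ℝ (Fin 3))} {u₀ : (EuclideanSpace ℝ (Fin 3))} (hu : Tendsto u atTop (𝓝 u₀)) :
    Tendsto (fun k => B k (u k)) atTop (𝓝 (A u₀)) := by
  rw [Metric.tendsto_nhds]
  intro ε hε
  have hε₁ : 0 < ε / 2 / (‖u₀‖ + 1) := by positivity
  filter_upwards [hB _ hε₁, Metric.tendsto_nhds.1 hu (ε / 2) (half_pos hε)] with k hk1 hk2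
  have h1 : ‖B k (u k) - B k u₀‖ = dist (u k) u₀ := by rw [← map_sub, (B k).norm_map, dist_eq_norm]
  have h2 : ‖B k u₀ - A u₀‖ ≤ ε / 2 / (‖u₀‖ + 1) * ‖u₀‖ := hk1 u₀
  have h3 : ε / 2 / (‖u₀‖ + 1) * ‖u₀‖ ≤ ε / 2 := by
    rw [div_mul_eq_mul_div, div_le_iff₀ (by positivity)]
    nlinarith [norm_nonneg u₀]
  calc dist (B k (u k)) (A u₀) ≤ ‖B k (u k) - B k u₀‖ + ‖B k u₀ - A u₀‖ := by
        rw [dist_eq_norm]; exact norm_sub_le_norm_sub_add_norm_sub _ _ _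
    _ < ε / 2 + ε / 2 := by rw [h1]; linarith
    _ = ε := by ring

/-- **Goodness passes to local limits (one pattern).** Let `P` be a non-empty pattern of unit
vectors, `Y k ⊆ ℝ³` `δ`-separated sets converging locally to the `δ`-separated `S`
(`BallMatch ε R 0 (Y k) S` eventually, all `R`, `ε > 0`), `p k ∈ Y k` with `p k → y ∈ S`, and
suppose every `p k` is `PatternGood P R₀` in `Y k`.  Then `y` is `PatternGood P R₀` in `S`.
[folklore] -/
theorem hge_patternGood_of_limit {P : Finset (EuclideanSpace ℝ (Fin 3))} (hP1 : ∀ v ∈ P, ‖v‖ = 1) (hPne : P.Nonempty)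
    {Y : ℕ → Set (EuclideanSpace ℝ (Fin 3))} {S : Set (EuclideanSpace ℝ (Fin 3))} {δ R₀ : ℝ} (hδ : 0 < δ)
    (hYsep : ∀ k, ∀ p ∈ Y k, ∀ q ∈ Y k, p ≠ q → δ ≤ dist p q)
    (hSsep : ∀ p ∈ S, ∀ q ∈ S, p ≠ q → δ ≤ dist p q)
    (hlim : ∀ R ε : ℝ, 0 < ε → ∀ᶠ k in atTop, BallMatch ε R 0 (Y k) S)
    {y : (EuclideanSpace ℝ (Fin 3))} {p : ℕ → (EuclideanSpace ℝ (Fin 3))} (hpY : ∀ k, p k ∈ Y k) (hpy : Tendsto p atTop (𝓝 y))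
    (hgood : ∀ k, PatternGood P R₀ (Y k) (p k)) : PatternGood P R₀ S y := by
  classical
  -- Step A: unbundle the data at every `p k`
  have hdata := fun k => (hgood k).exists_data hδ hP1 hPne (hYsep k) (hpY k)
  choose d A q hd hδd hdR hq hinj hsurj hdle hmin using hdata
  -- Step B: extract convergence of the isometries, then of scales and offsets
  obtain ⟨ψ₁, Alim, hψ₁, hA⟩ := hge_extract_isometry A
  obtain ⟨ψ₂, dlim, wlim, hψ₂, hdlim, hdconv, hwconv⟩ :=
    hge_extract_bounded (ι := ↥P) (a := δ) (b := R₀) (C := 21 / 20 * R₀)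
      (fun k => d (ψ₁ k)) (fun k v => q (ψ₁ k) v - p (ψ₁ k)) (fun k => ⟨hδd _, hdR _⟩)
      (fun k v => by
        rw [← dist_eq_norm]
        have h1 := (hq (ψ₁ k) v).2.2.2.2.2
        have h2 := hdR (ψ₁ k)
        nlinarith)
  set ψ : ℕ → ℕ := fun k => ψ₁ (ψ₂ k) with hψ_def
  have hψ : StrictMono ψ := hψ₁.comp hψ₂
  -- convergences along `ψ`
  have hlimψ : ∀ R ε : ℝ, 0 < ε → ∀ᶠ k in atTop, BallMatch ε R 0 (Y (ψ k)) S :=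
    fun R ε hε => hψ.tendsto_atTop.eventually (hlim R ε hε)
  have hYsepψ : ∀ k, ∀ p ∈ Y (ψ k), ∀ q ∈ Y (ψ k), p ≠ q → δ ≤ dist p q := fun k => hYsep (ψ k)
  have hpψ : Tendsto (fun k => p (ψ k)) atTop (𝓝 y) := hpy.comp hψ.tendsto_atTop
  have hdψ : Tendsto (fun k => d (ψ k)) atTop (𝓝 dlim) := hdconv
  have hAψ : ∀ ε : ℝ, 0 < ε → ∀ᶠ k in atTop, ∀ v : (EuclideanSpace ℝ (Fin 3)), ‖A (ψ k) v - Alim v‖ ≤ ε * ‖v‖ :=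
    fun ε hε => hψ₂.tendsto_atTop.eventually (hA ε hε)
  set qlim : ↥P → (EuclideanSpace ℝ (Fin 3)) := fun v => wlim v + y with hqlim_def
  have hqψ : ∀ v, Tendsto (fun k => q (ψ k) v) atTop (𝓝 (qlim v)) := fun v => by
    have := (hwconv v).add hpψ
    simpa [hψ_def, sub_add_cancel] using this
  have hdlim0 : 0 < dlim := hδ.trans_le hdlim.1
  -- (5a) the limit neighbours lie in `S`
  have hqS : ∀ v, qlim v ∈ S := fun v =>
    hge_mem_of_tendsto hδ hSsep hlimψ (Eventually.of_forall fun k => (hq (ψ k) v).1) (hqψ v)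
  -- (5b) they differ from `y`
  have hqy_dist : ∀ v, δ ≤ dist (qlim v) y := fun v =>
    hge_le_dist_of_tendsto (hqψ v) hpψ (Eventually.of_forall fun k =>
      hYsep _ _ (hq (ψ k) v).1 _ (hpY _) (hq (ψ k) v).2.1).frequently
  have hqy : ∀ v, qlim v ≠ y := fun v h => by
    have := hqy_dist v
    rw [h, dist_self] at this
    linarith
  -- (5c) the closed matching condition persists
  have hqA : ∀ v, dist (dlim⁻¹ • (qlim v - y)) (Alim (v : (EuclideanSpace ℝ (Fin 3)))) ≤ 1 / 20 := fun v => by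
    have hconv : Tendsto (fun k => dist ((d (ψ k))⁻¹ • (q (ψ k) v - p (ψ k))) (A (ψ k) (v : (EuclideanSpace ℝ (Fin 3)))))
        atTop (𝓝 (dist (dlim⁻¹ • (qlim v - y)) (Alim (v : (EuclideanSpace ℝ (Fin 3)))))) := by
      refine Tendsto.dist (Tendsto.smul (hdψ.inv₀ hdlim0.ne') ((hqψ v).sub hpψ)) ?_
      exact hge_tendsto_isometry_apply hAψ tendsto_const_nhds
    exact le_of_tendsto' hconv fun k => (hq (ψ k) v).2.2.2.1
  -- hence the annulus in the limit
  have hqlt : ∀ v, dist (qlim v) y < 13 / 10 * dlim := fun v => by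
    have := (hge_annulus hdlim0 (by rw [Alim.norm_map, hP1 _ v.2]) (hqA v)).2
    rw [← dist_eq_norm] at this
    linarith
  -- (5e) distinct labels give distinct limit neighbours
  have hinjlim : Function.Injective qlim := fun v w hvw => by
    by_contra hne
    have hsep : δ ≤ dist (qlim v) (qlim w) :=
      hge_le_dist_of_tendsto (hqψ v) (hqψ w) (Eventually.of_forall fun k =>
        hYsep _ _ (hq (ψ k) v).1 _ (hq (ψ k) w).1 (fun h => hne (hinj _ h))).frequently
    rw [hvw, dist_self] at hsep
    linarith
  -- (5f) every other point of `S` near `y`: follow it back along approximants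
  have hback : ∀ z ∈ S, z ≠ y →
      dlim ≤ dist z y ∧ (dist z y < 13 / 10 * dlim → ∃ v, qlim v = z) := by
    intro z hz hzy
    obtain ⟨ha, haz⟩ := hge_exists_approx hδ hYsepψ hlimψ hz
    set a : ℕ → (EuclideanSpace ℝ (Fin 3)) := fun k => nearPt (Y (ψ k)) z with ha_def
    have hdza : Tendsto (fun k => dist (a k) (p (ψ k))) atTop (𝓝 (dist z y)) := haz.dist hpψ
    have hzy0 : 0 < dist z y := dist_pos.2 hzy
    have hne : ∀ᶠ k in atTop, a k ≠ p (ψ k) := by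
      filter_upwards [hdza.eventually (Ioi_mem_nhds (half_lt_self hzy0))] with k hk h
      rw [h, dist_self] at hk
      linarith
    constructor
    · refine le_of_tendsto_of_tendsto hdψ hdza ?_
      filter_upwards [ha, hne] with k hk1 hk2
      exact hdle _ _ hk1 hk2
    · intro hlt
      have hev : ∀ᶠ k in atTop, ∃ v, q (ψ k) v = a k := by
        have h13 : Tendsto (fun k => dist (a k) (p (ψ k)) - 13 / 10 * d (ψ k)) atTop
            (𝓝 (dist z y - 13 / 10 * dlim)) := hdza.sub (hdψ.const_mul _)
        filter_upwards [ha, hne, h13.eventually (Iio_mem_nhds (by linarith : dist z y - 13 / 10 * dlim < 0))]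
          with k hk1 hk2 hk3
        exact hsurj _ _ hk1 hk2 (by linarith)
      obtain ⟨v, hv⟩ := hge_frequently_exists_of_finite hev
      exact ⟨v, tendsto_nhds_unique_of_frequently_eq (hqψ v) haz hv⟩
  -- (5g) the minimal distance is attained at a fixed label
  have hminlim : ∃ v, dist (qlim v) y = dlim := by
    obtain ⟨v, hv⟩ := hge_frequently_exists_of_finite
      (Eventually.of_forall fun k => hmin (ψ k) : ∀ᶠ k in atTop, ∃ v, dist (q (ψ k) v) (p (ψ k)) = d (ψ k))
    exact ⟨v, tendsto_nhds_unique_of_frequently_eq ((hqψ v).dist hpψ) hdψ hv⟩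
  -- rebundle
  exact patternGood_of_data dlim Alim qlim hdlim.2 hqS hqy hqlt hqA hinjlim
    (fun z hz hzy hlt => (hback z hz hzy).2 hlt) hminlim (fun z hz hzy => (hback z hz hzy).1)

end Summit.AtomisticToContinuum.Crystallization.Theorems

end
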